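/-
Copyright (c) 2026. All rights reserved.
Released under Apache 2.0 license as described in the file LICENSE.
Authors: abc-iut cell, prover seat abc-iut-f-066 (gen 8; row «C55iii-TELECORE@ARC+TWO-SIDED» (a1), abc-iut-L4-lead m202 (2)),
the archimedean twin of abc-iut-L4-t5's `LogFrobeniusAnTelecoreObservablesGenuine.lean` (file 10 of row «F3757-PORT»), built
from abc-iut-L4-d3's read-only by-name table (STATUS 2026-08-27 08:28Z); every input is consumed BY NAME (abc-iut-L4-t5,
abc-iut-w5-d053, abc-iut-w5-d144, abc-iut-f-095, abc-iut-f-101, abc-iut-w4-d095 / abc-iut-L4-t3 lineages) — nothing restated.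
-/
import Literature.AnabelianGeometry.AbsoluteAnabelian.LogFrobeniusAnTelecoreObservablesGenuine
import Literature.AnabelianGeometry.AbsoluteAnabelian.LogFrobeniusGenuineIotaOver
import Literature.AnabelianGeometry.AbsoluteAnabelian.LogFrobeniusLamOverLink
import Literature.AnabelianGeometry.AbsoluteAnabelian.LogFrobeniusArchGenuineObservables
import Literature.AnabelianGeometry.AbsoluteAnabelian.ArchimedeanHolFieldFunctorGeometric
import HarnessLib

/-!
# [AbsTopIII] Cor 5.5 (iii), last sentence: `𝔗_{An•}`, the core at `ℰ•`, `S_log`, `S_log⊞` are compatible — AT THE GENUINE-ARCHIMEDEAN CARRIER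

S. Mochizuki, *Topics in absolute anabelian geometry III: global reconstruction algorithms* [MochizukiAbsTopIII2015]; locators
`p.N` = pages of the author's manuscript (`paper:url-5493eb38cbb7`), read on the page (cell render
`AbsTopIII-kurims-url-5493eb38cbb7`): Cor 5.5 (iii) p. 131 l. 30–40 ("the families of homotopies that constitute `S_log` and
`S_log⊞` are compatible with one another as well as with the families of homotopies that constitute the core and telecore
structures of (i), (ii)"), Def 3.5 (ii) p. 75 ("compatible"), Rmk 3.5.1 p. 78, Def 5.4 (v) p. 127 (the archimedean graph
`Γ⃗^⋉_v`: `k~ → k~ ↠ k^× ↪ k`).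

PROOF-ONLY file (no definition, no instance, no named-fact hypothesis).  abc-iut-w5-d144 typed the last sentence of
Cor 5.5 (iii), inside `D_{An•}`, as the assumption `Cor55ObservablesTelecoreCompatible L TS` (FACT-LIST F-3757); abc-iut-L4-t5
proved the SUFFICIENCY `cor55ObservablesTelecoreCompatible_of` (file 8), the over-ness bridges (file 9) and discharged every
binder at abc-iut-f-101's genuine open-augmentation carrier `genuineOpen p V` — ALL places nonarchimedean (file 10).  HERE the
same binders are discharged at abc-iut-w4-d095's setting with GENUINE ARCHIMEDEAN COMPONENTS `archGenuine 𝔄 Vmod isArc`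
(`𝒳 := 𝒞^hol_TF` over an arbitrary Aut-holomorphic field functor `𝔄`, `ℰ• := EA`, `An• := LinHol`; at an archimedean `v` the
`λ⊞`/`ι⊞` realise Def 5.4 (v)'s graph by Def 4.1 (iv)'s `λ^∼`, `λ^×`, `ι_×`), for EVERY index set `Vmod ≠ ∅`, EVERY `isArc`, and
ANY `TS`-datum `T` whose `ι` lie over `Th•[Z]` (`T.IotaOverTS`) — in particular the carrier's own `archGenuineTS 𝔄 Vmod isArc`
(abc-iut-L4-t3: `archGenuineTS_iotaOverTS`):
* `Hplus v :=` abc-iut-f-101's `logObsFamily v` over abc-iut-f-095's `archGenuine_iotaSquaresCommute`; `Hts v := logObsFamilyTS v T`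
  over `archGenuine_iotaSquaresCommuteTS` (abc-iut-L4-t5's `iotaSquaresCommuteTS_of_iotaSquaresCommute`); `hpush :=`
  abc-iut-w5-d144's `subFamily_pushFamily_logObsFamilyTS`; `hobs :=` the generic `isLogObservablePlus_logObsFamily` /
  `isLogObservableTS_logObsFamilyTS`; `hreflPlus` / `hreflTS` := the empty chain (file 10's `logObsFamily(TS)_E_refl`);
* `hoverPlus` / `hoverTS` := file 9's bridges over abc-iut-w5-d144's `isOver_logObsFamily_η` / `isOver_logObsFamilyTS_η`, fed with
  `archGenuine_iotaOver`, `archGenuine_lamOverLink` (abc-iut-L4-t3 / abc-iut-f-101 lineages) and `T.IotaOverTS`.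
Results: `archGenuine_iotaSquaresCommuteTS`, `archGenuine_isLogObservable_pair`, `archGenuine_hoverPlus`, `archGenuine_hoverTS`;
★ `cor55ObservablesTelecoreCompatible_archGenuine_of_iotaOverTS` (every `T` with `T.IotaOverTS`);
★★ `cor55ObservablesTelecoreCompatible_archGenuine` (the carrier's own `TS`-datum; zero hypotheses beyond `Vmod ≠ ∅`);
`…_iff` (⟺ `Vmod ≠ ∅`); the concrete geometric instance `HolRS.cor55ObservablesTelecoreCompatible_archGenuine_geometric` (all
connected Riemann surfaces, one archimedean place) and `exists_arch_cor55ObservablesTelecoreCompatible` (an all-archimedean index).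

HONEST LABELS: MODEL-LEVEL at a carrier of the cell's own construction; FROZEN interface — at an archimedean `v` the `ι⊞_{v,ε}`
are indexed by the frozen `LogFrobeniusSetting`'s edge set (cell typing finding T3g9-F1: the successor interface `⋉` re-indexes
them by the edges of `Γ⃗^⋉_v`; abc-iut-L4-lead m202 ruled the frozen interface is the print reading for THIS sentence, which has
no `ι`/`η` arc obstruction); (L2) at indices that are not all-archimedean the nonarchimedean components of `archGenuine` are
the docstring's PLACEHOLDERS (identities).  The typed statement is abc-iut-w5-d144's reading of the printed sentence; refereed
pre-IUT material; nothing here bears on [IUTchIII] Cor. 3.12; no side taken; typed ≠ proved for print's theaters.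
-/

set_option autoImplicit false

universe u

open CategoryTheory Quiver

namespace Literature.AnabelianGeometry.AbsoluteAnabelian

namespace LogFrobeniusSetting

open AbsTopIII DiagramOfCategories

section Instance

variable (𝔄 : AutHolFieldFunctor.{u}) (Vmod : Type (u + 1)) (isArc : Vmod → Bool)

/-- The `TS` ι-diamond law at the genuine-archimedean carrier, every place, every `TS`-datum (from abc-iut-f-095's
`archGenuine_iotaSquaresCommute` by abc-iut-L4-t5's `iotaSquaresCommuteTS_of_iotaSquaresCommute`).
[cite: MochizukiAbsTopIII2015, Definition 5.4 (iii) p.126] -/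
theorem archGenuine_iotaSquaresCommuteTS (T : (archGenuine 𝔄 Vmod isArc).TSHomotopies) (v : Vmod) :
    (archGenuine 𝔄 Vmod isArc).IotaSquaresCommuteTS T v :=
  (archGenuine 𝔄 Vmod isArc).iotaSquaresCommuteTS_of_iotaSquaresCommute v T (archGenuine_iotaSquaresCommute 𝔄 Vmod isArc v)

/-- **The pair of observable families at a place `v` of the genuine-archimedean carrier**: `Hplus v := logObsFamily v` is an
`S_log⊞_v` and `Hts v := logObsFamilyTS v T` is an `S_log_v`. [cite: MochizukiAbsTopIII2015, Cor 5.5 (iii) p. 131] -/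
theorem archGenuine_isLogObservable_pair (T : (archGenuine 𝔄 Vmod isArc).TSHomotopies) (v : Vmod) :
    (archGenuine 𝔄 Vmod isArc).IsLogObservablePlus v
        ((archGenuine 𝔄 Vmod isArc).logObsFamily v (archGenuine_iotaSquaresCommute 𝔄 Vmod isArc v)) ∧
      (archGenuine 𝔄 Vmod isArc).IsLogObservableTS T v
        ((archGenuine 𝔄 Vmod isArc).logObsFamilyTS v T (archGenuine_iotaSquaresCommuteTS 𝔄 Vmod isArc T v)) :=
  ⟨(archGenuine 𝔄 Vmod isArc).isLogObservablePlus_logObsFamily v (archGenuine_iotaSquaresCommute 𝔄 Vmod isArc v),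
    (archGenuine 𝔄 Vmod isArc).isLogObservableTS_logObsFamilyTS v T (archGenuine_iotaSquaresCommuteTS 𝔄 Vmod isArc T v)⟩

/-- **`hoverPlus` at the genuine-archimedean carrier**: every homotopy of the universal `⊞`-observable family `S_log⊞_v` of
`archGenuine 𝔄 Vmod isArc`, read inside `D_{An•}`, lies over `Th•[Z]` for file 1's `anOverE` — file 9's bridge over
abc-iut-w5-d144's `isOver_logObsFamily_η`, fed with `archGenuine_iotaOver` and `archGenuine_lamOverLink`.
[cite: MochizukiAbsTopIII2015, Remark 3.5.1 p.78] -/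
theorem archGenuine_hoverPlus (v : Vmod) (a : (logShapePlus (isArc := isArc) v).Vertex)
    (q r : Path a (logShapePlus (isArc := isArc) v).obs)
    (h : ((archGenuine 𝔄 Vmod isArc).logObsFamily v (archGenuine_iotaSquaresCommute 𝔄 Vmod isArc v)).E q r) :
    (archGenuine 𝔄 Vmod isArc).anOverE.IsOver ((plusEmb (Vmod := Vmod) (isArc := isArc) v).mapPath q)
      ((plusEmb (Vmod := Vmod) (isArc := isArc) v).mapPath r)
      ((archGenuine 𝔄 Vmod isArc).embPlusHomAn v
        ((archGenuine 𝔄 Vmod isArc).logObsFamily v (archGenuine_iotaSquaresCommute 𝔄 Vmod isArc v)) h) :=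
  (archGenuine 𝔄 Vmod isArc).isOver_embPlusHomAn_of_isOver v _ h
    ((archGenuine 𝔄 Vmod isArc).isOver_logObsFamily_η v (archGenuine_iotaOver 𝔄 Vmod isArc)
      (archGenuine_lamOverLink 𝔄 Vmod isArc) _ h)

/-- **`hoverTS` at the genuine-archimedean carrier**, for every `TS`-datum `T` whose `ι` lie over `Th•[Z]` (`T.IotaOverTS`).
[cite: MochizukiAbsTopIII2015, Remark 3.5.1 p.78] -/
theorem archGenuine_hoverTS (T : (archGenuine 𝔄 Vmod isArc).TSHomotopies) (hT : T.IotaOverTS) (v : Vmod)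
    (a : (logShapeTS (isArc := isArc) v).Vertex) (q r : Path a (logShapeTS (isArc := isArc) v).obs)
    (h : ((archGenuine 𝔄 Vmod isArc).logObsFamilyTS v T (archGenuine_iotaSquaresCommuteTS 𝔄 Vmod isArc T v)).E q r) :
    (archGenuine 𝔄 Vmod isArc).anOverE.IsOver ((tsEmb (Vmod := Vmod) (isArc := isArc) v).mapPath q)
      ((tsEmb (Vmod := Vmod) (isArc := isArc) v).mapPath r)
      ((archGenuine 𝔄 Vmod isArc).embTSHomAn v
        ((archGenuine 𝔄 Vmod isArc).logObsFamilyTS v T (archGenuine_iotaSquaresCommuteTS 𝔄 Vmod isArc T v)) h) :=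
  (archGenuine 𝔄 Vmod isArc).isOver_embTSHomAn_of_isOver v _ h
    ((archGenuine 𝔄 Vmod isArc).isOver_logObsFamilyTS_η v T hT (archGenuine_lamOverLink 𝔄 Vmod isArc) _ h)

/-- ★ **Cor 5.5 (iii), last sentence, inside `D_{An•}`, AT THE GENUINE-ARCHIMEDEAN CARRIER, for every `TS`-datum `T` with
`T.IotaOverTS`** (`Vmod ≠ ∅`, every `isArc`, every Aut-holomorphic field functor `𝔄`): ONE family of homotopies on `D_{An•}`
contains the telecore family `𝒥` of `𝔗_{An•}`, the embedded core family of `ℰ•` and the embedded `S_log⊞_v`, `S_log_v` at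
every `v` — abc-iut-L4-t5's sufficiency theorem with every binder discharged. [cite: MochizukiAbsTopIII2015, Cor 5.5 (iii) p. 131] -/
theorem cor55ObservablesTelecoreCompatible_archGenuine_of_iotaOverTS [Nonempty Vmod]
    (T : (archGenuine 𝔄 Vmod isArc).TSHomotopies) (hT : T.IotaOverTS) :
    (archGenuine 𝔄 Vmod isArc).Cor55ObservablesTelecoreCompatible T :=
  (archGenuine 𝔄 Vmod isArc).cor55ObservablesTelecoreCompatible_of
    (Hplus := fun v => (archGenuine 𝔄 Vmod isArc).logObsFamily v (archGenuine_iotaSquaresCommute 𝔄 Vmod isArc v))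
    (Hts := fun v =>
      (archGenuine 𝔄 Vmod isArc).logObsFamilyTS v T (archGenuine_iotaSquaresCommuteTS 𝔄 Vmod isArc T v))
    (hpush := fun v => (archGenuine 𝔄 Vmod isArc).subFamily_pushFamily_logObsFamilyTS v T _ _)
    (hoverPlus := fun v a q r h => archGenuine_hoverPlus 𝔄 Vmod isArc v a q r h)
    (hoverTS := fun v a q r h => archGenuine_hoverTS 𝔄 Vmod isArc T hT v a q r h)
    (hreflPlus := fun v _ q => (archGenuine 𝔄 Vmod isArc).logObsFamily_E_refl v _ q)
    (hreflTS := fun v _ q => (archGenuine 𝔄 Vmod isArc).logObsFamilyTS_E_refl v T _ q)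
    (TS := T)
    (hobs := fun v => archGenuine_isLogObservable_pair 𝔄 Vmod isArc T v)

/-- ★★ **Cor 5.5 (iii), last sentence, inside `D_{An•}`, AT THE GENUINE-ARCHIMEDEAN CARRIER with its own `TS`-datum**
(abc-iut-L4-t3's `archGenuineTS 𝔄 Vmod isArc`, whose `ι` lie over `Th•[Z]` by `archGenuineTS_iotaOverTS`; zero hypotheses beyond
`Vmod ≠ ∅`). [cite: MochizukiAbsTopIII2015, Cor 5.5 (iii) p. 131] -/
theorem cor55ObservablesTelecoreCompatible_archGenuine [Nonempty Vmod] :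
    (archGenuine 𝔄 Vmod isArc).Cor55ObservablesTelecoreCompatible (archGenuineTS 𝔄 Vmod isArc) :=
  cor55ObservablesTelecoreCompatible_archGenuine_of_iotaOverTS 𝔄 Vmod isArc (archGenuineTS 𝔄 Vmod isArc)
    (archGenuineTS_iotaOverTS 𝔄 Vmod isArc)

/-- **The statement at the genuine-archimedean carrier EXACTLY**: it holds iff `Vmod ≠ ∅` (abc-iut-w5-d144's
`not_cor55ObservablesTelecoreCompatible_of_isEmpty` is the degenerate corner). [cite: MochizukiAbsTopIII2015, Cor 5.5 (iii) p. 131] -/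
theorem cor55ObservablesTelecoreCompatible_archGenuine_iff :
    (archGenuine 𝔄 Vmod isArc).Cor55ObservablesTelecoreCompatible (archGenuineTS 𝔄 Vmod isArc) ↔ Nonempty Vmod := by
  refine ⟨fun h => ?_, fun _ => cor55ObservablesTelecoreCompatible_archGenuine 𝔄 Vmod isArc⟩
  by_contra hV
  haveI : IsEmpty Vmod := not_nonempty_iff.mp hV
  exact (archGenuine 𝔄 Vmod isArc).not_cor55ObservablesTelecoreCompatible_of_isEmpty (archGenuineTS 𝔄 Vmod isArc) h

end Instance

/-- Hence a §5 setting over an ALL-ARCHIMEDEAN index (`isArc := fun _ => true`) with `V(F_mod) ≠ ∅` and a `TS`-datum satisfying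
the typed Cor 5.5 (iii) telecore-compatibility clause EXIST, over every Aut-holomorphic field functor (model-level non-vacuity
of abc-iut-w5-d144's `Cor55ObservablesTelecoreCompatible` at archimedean places). [cite: MochizukiAbsTopIII2015, Cor 5.5 (iii) p. 131] -/
theorem exists_arch_cor55ObservablesTelecoreCompatible (𝔄 : AutHolFieldFunctor.{u}) (Vmod : Type (u + 1)) [Nonempty Vmod] :
    ∃ (L : LogFrobeniusSetting Vmod (fun _ => true)) (T : L.TSHomotopies), L.Cor55ObservablesTelecoreCompatible T :=
  ⟨archGenuine 𝔄 Vmod (fun _ => true), archGenuineTS 𝔄 Vmod (fun _ => true),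
    cor55ObservablesTelecoreCompatible_archGenuine 𝔄 Vmod (fun _ => true)⟩

end LogFrobeniusSetting

/-! ## The concrete geometric instance -/

namespace HolRS

open LogFrobeniusSetting

/-- **Concrete, no variable left but the object property**: at the geometric Aut-holomorphic field functor on connected
Riemann surfaces (`geometricAutHolFieldFunctor Q`), ONE archimedean place, the typed last sentence of Cor 5.5 (iii) holds at
the genuine-archimedean carrier with its own `TS`-datum. [cite: MochizukiAbsTopIII2015, Cor 5.5 (iii) p. 131] -/
theorem cor55ObservablesTelecoreCompatible_archGenuine_geometric (Q : ObjectProperty HolRS) :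
    (archGenuine (geometricAutHolFieldFunctor Q) PUnit.{2} (fun _ => true)).Cor55ObservablesTelecoreCompatible
      (archGenuineTS (geometricAutHolFieldFunctor Q) PUnit.{2} (fun _ => true)) :=
  cor55ObservablesTelecoreCompatible_archGenuine (geometricAutHolFieldFunctor Q) PUnit (fun _ => true)

end HolRS

end Literature.AnabelianGeometry.AbsoluteAnabelian
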